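import Summits.BirchSwinnertonDyer.Rank1Residual.Additive.CongruentLambdaShiftOfGVTorsionIso
import Summits.BirchSwinnertonDyer.Rank1Residual.Additive.GordGreenbergKummerIdentification
import Summits.BirchSwinnertonDyer.Rank1Residual.AdditivePotMult.RamifiedOrdinaryLineMatchingMixed
import Summits.BirchSwinnertonDyer.Rank1Residual.AdditivePotMult.PotMultRamifiedLineKummerEqAt
import Summits.BirchSwinnertonDyer.Rank1Residual.Additive.TorsionOrderOfTorsionIso
import HarnessLib

/-!
# Route G on MIXED (G-ord, `e = 2`)–(M) congruent pairs via the Greenberg–Vatsal record, with BOTH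
# R-D binders and the line data DISCHARGED (cell `b2b-bsdres`, team n1011, seat p07 (gen 5); row
# T-RD-M sequel (v) — consumer of `RamifiedOrdinaryLineMatchingMixed` (lines, matched), n1011-p05's
# `GordGreenbergKummerIdentification` (R-D on the (G-ord) side, mod `hGrK`) and
# `PotMultRamifiedLineKummerEqAt` (R-D on the (M) side, mod A40/A41))

HONEST FRAMING (cell `b2b-bsdres`, run/shared/lean/b2b/bsd-rank1-residual/, verbatim in every
file): the goal of the cell is to DELETE the COMBINATION-SHAPED residual classes of the
Birch–Swinnerton-Dyer formula for ALL analytic-rank `≤ 1` elliptic curves over `ℚ` — "full BSD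
formula for every rank `≤ 1` curve in class `C`" assembled STRICTLY from published theorems — so
that the rank-`≤ 1` remainder becomes exactly the CONSTRUCTION-SHAPED classes, which are TYPED
(missing-input `Prop`s), NOT attempted. This is not "finishing BSD". Team n1011 (N10/N11, (M) rows):
research route; labels and marks UNCHANGED; nothing booked. Consumer theorems only; NO definition; NO
Literature fact; the named facts entering as HYPOTHESES are cc-typer-2's GV §2 composed record `hGV`
(`GreenbergVatsal2000.muLambdaAlg_transfer_of_torsionIso_potOrd_of_not_dvd_torsionOrder`), A239
`hGrK` (`Greenberg1999.imKummer_ge_strictCondition_goodOrdinary`, the (G-ord) side) and the published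
Tate uniformisation A40/A41 (`hT40`/`hT41`, the (M) side). Debt 0.

## What

For a congruent pair at the same odd prime `p` with `E₁ = W₁` additive of type (G)-ordinary,
`semistabilityIndex W₁ p = 2` (X4♯(G-ord) ∩ `I₀*` / X3♯(G-ord) ∩ `I₀*`) and `E₂ = W₂` additive
potentially multiplicative (X4(M) / X3♯(M)) — or the other way round — cc-typer-2's line-explicit
`congruentLambdaShift_of_gv` / `mu_eq_zero_of_gv` are fed with: the matched ramified ordinary lines of
`RamifiedOrdinaryLineMatchingMixed.exists_lines_matching_of_typeGOrd_potMult` / `_of_potMult_typeGOrd`;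
the R-D identification `RamifiedLineKummerEqAt W₁ p` of the (G-ord) member
(`ramifiedLineKummerEqAt_of_goodOrd_pStar_twist`, n1011-p05, mod `hGrK`) and of the (M) member
(`PotMult.ramifiedLineKummerEqAt`, this seat, mod A40/A41). Results (`CongruentLambdaShift W₁ W₂ p
(Σ_{w∈Σ₀} (δ(E₂,w) − δ(E₁,w)))` and `μ(X(E₁)) = 0 ⟹ μ(X(E₂)) = 0`):
`congruentLambdaShift_of_gv_of_typeGOrd_potMult`, `mu_eq_zero_of_gv_of_typeGOrd_potMult`,
`congruentLambdaShift_of_gv_of_potMult_typeGOrd`, `mu_eq_zero_of_gv_of_potMult_typeGOrd`; class forms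
`ClassX4Gord.congruentLambdaShift_of_gv_of_multPartner` / `ClassX4M.congruentLambdaShift_of_gv_of_gordPartner`
(torsion conditions by irreducibility) and `ClassX3M.…_of_gordPartner` / `ClassX3Gord.…_of_multPartner`
(census torsion conditions), with the `mu_eq_zero` twins. Remaining inputs on a mixed pair: `hGV`,
`hGrK`, A40/A41, `TorsionIso`, `Σ₀` (+ on X3 ONE census bit `p ∤ #E₁(ℚ)_tors`, the partner's
following by cc-typer-2's `not_dvd_torsionOrder_of_torsionIso`); NO line / R-D / image binder.
All classes stay CONSTRUCTION-SHAPED; nothing booked; no mark moved.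

References: R. Greenberg, V. Vatsal, Invent. Math. 142 (2000) §2 pp. 26–27; R. Greenberg, LNM 1716
(1999) Props. 2.2, 2.4, 4.14; B. Mazur, Publ. IHÉS 47 (1977) III §5; J. H. Silverman, *ATAEC* V.5.3,
Cor. V.5.4; M. Emerton, R. Pollack, T. Weston, Invent. Math. 163 (2006) §3.1.
-/

noncomputable section

open scoped Classical NumberField

namespace Summit.BirchSwinnertonDyer.Rank1Residual.AdditivePotMult

open NumberField IsDedekindDomain Field WeierstrassCurve
  Literature.NumberTheory.GaloisRepresentations
  Literature.NumberTheory.EllipticCurves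
  Literature.NumberTheory.EllipticCurves.Rank1Residual
  Literature.NumberTheory.EllipticCurves.GreenbergSelmer
  Literature.NumberTheory.EllipticCurves.Greenberg1999
  Literature.NumberTheory.EllipticCurves.GreenbergVatsal2000
  Literature.NumberTheory.EllipticCurves.EmertonPollackWeston2006
  Summit.BirchSwinnertonDyer.Rank1Residual.X1.CongruenceTransfer
  Summit.BirchSwinnertonDyer.Rank1Residual.Additive
  Summit.BirchSwinnertonDyer.Rank1Residual.AdditivePotMult.RamifiedOrdinaryLineMatchingMixed

variable {p : ℕ} [hp : Fact p.Prime] {W₁ W₂ : WeierstrassCurve ℚ} [W₁.IsElliptic]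
  [W₁.IsGloballyMinimal] [W₂.IsElliptic] [W₂.IsGloballyMinimal]

/-- The place `v_p` of `ℚ` above `p` (`Rat.HeightOneSpectrum.primesEquiv`). [folklore] -/
private theorem exists_natCast_mem_asIdeal' :
    ∃ v : HeightOneSpectrum (𝓞 ℚ), ((p : ℕ) : 𝓞 ℚ) ∈ v.asIdeal :=
  ⟨(Rat.HeightOneSpectrum.primesEquiv (R := 𝓞 ℚ)).symm ⟨p, hp.out⟩,
    (natCast_mem_asIdeal_iff_eq_primesEquiv_symm _ hp.out).mpr rfl⟩

omit [W₂.IsElliptic] [W₂.IsGloballyMinimal] in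
/-- R-D on the (G-ord, `e = 2`) member, mod `hGrK` (n1011-p05's model-level
`ramifiedLineKummerEqAt_of_goodOrd_pStar_twist` on the good-ordinary `p*`-twist model
`TypeGOrd.exists_goodOrd_pStar_twist_model`). [cite: GreenbergLNM1716, §2 Props. 2.2, 2.4 (pp. 73–75), §5 p. 143] -/
theorem ramifiedLineKummerEqAt_of_typeGOrd (hGrK : imKummer_ge_strictCondition_goodOrdinary)
    (hp2 : p ≠ 2) (hG : TypeGOrd W₁ p) (hadd : Addv W₁ p) (he : semistabilityIndex W₁ p = 2) :
    RamifiedLineKummerEqAt W₁ p := by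
  obtain ⟨V, _, _, C, hV, hC⟩ := TypeGOrd.exists_goodOrd_pStar_twist_model W₁ p hp2 hG hadd he
  exact ramifiedLineKummerEqAt_of_goodOrd_pStar_twist p hGrK hp2 V ⟨C, hC⟩ hV

/-! ### §1 Generic mixed pairs: (G-ord, `e = 2`) × pot-mult and pot-mult × (G-ord, `e = 2`) -/

/-- **(G-ord, `e = 2`)–(M) congruent pairs, every odd `p`: `CongruentLambdaShift W₁ W₂ p e`,
`e = Σ_{w∈Σ₀} (δ(E₂,w) − δ(E₁,w))`, from the GV record + `TorsionIso` + `p ∤ #Eᵢ(ℚ)_tors` + `Σ₀`**,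
mod `hGrK` (member 1) and A40/A41 (member 2); NO line / R-D / image binder. Nothing booked.
[cite: GreenbergVatsal2000, §2 Prop. (2.8) with Remark (2.9), Cor. (2.3), Prop. (2.4), pp. 26–27 (arXiv:math/9906215)] -/
theorem congruentLambdaShift_of_gv_of_typeGOrd_potMult
    (hGV : muLambdaAlg_transfer_of_torsionIso_potOrd_of_not_dvd_torsionOrder)
    (hGrK : imKummer_ge_strictCondition_goodOrdinary)
    (hT40 : Silverman1994_thmV53_tateUniformisation.{0})
    (hT41 : Silverman1994_thmV53_corV54_tateUniformisation.{0}) (hp2 : p ≠ 2)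
    (hG₁ : TypeGOrd W₁ p) (hadd₁ : Addv W₁ p) (he₁ : semistabilityIndex W₁ p = 2)
    (hpm₂ : PotMult W₂ p) (htors₁ : ¬ p ∣ W₁.torsionOrder) (htors₂ : ¬ p ∣ W₂.torsionOrder)
    (hT : TorsionIso W₁ W₂ p)
    (S₀ : Finset (HeightOneSpectrum (𝓞 ℚ))) (hS₀ : ∀ w ∈ S₀, ((p : ℕ) : 𝓞 ℚ) ∉ w.asIdeal)
    (hS₁ : ∀ w : HeightOneSpectrum (𝓞 ℚ), w ∉ S₀ → ((p : ℕ) : 𝓞 ℚ) ∉ w.asIdeal →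
      W₁.HasGoodReductionAt w)
    (hS₂ : ∀ w : HeightOneSpectrum (𝓞 ℚ), w ∉ S₀ → ((p : ℕ) : 𝓞 ℚ) ∉ w.asIdeal →
      W₂.HasGoodReductionAt w) :
    CongruentLambdaShift W₁ W₂ p (∑ w ∈ S₀, ((delta W₂ p w : ℤ) - (delta W₁ p w : ℤ))) := by
  obtain ⟨v, hv⟩ := exists_natCast_mem_asIdeal' (p := p)
  obtain ⟨L₁, L₂, hL₁, hL₂, hmatch⟩ :=
    exists_lines_matching_of_typeGOrd_potMult hT40 hT41 hp2 hG₁ hadd₁ he₁ hpm₂ hv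
  obtain ⟨e, he⟩ := hT
  exact congruentLambdaShift_of_gv W₁ W₂ p S₀ hGV hp2 hv hL₁ hL₂ htors₁ htors₂
    (ramifiedLineKummerEqAt_of_typeGOrd hGrK hp2 hG₁ hadd₁ he₁)
    (hpm₂.ramifiedLineKummerEqAt hT40 hT41 hp2) ⟨e, he, hmatch e he⟩ hS₀ hS₁ hS₂

/-- **(G-ord, `e = 2`)–(M) congruent pairs: `μ(X(E₁)) = 0 ⟹ μ(X(E₂)) = 0`** from the GV record +
`TorsionIso` + `p ∤ #Eᵢ(ℚ)_tors` + `Σ₀`, mod `hGrK` | A40/A41. Nothing booked.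
[cite: GreenbergVatsal2000, §2 Prop. (2.8) with Remark (2.9), Cor. (2.3), pp. 26–27 (arXiv:math/9906215)] -/
theorem mu_eq_zero_of_gv_of_typeGOrd_potMult
    (hGV : muLambdaAlg_transfer_of_torsionIso_potOrd_of_not_dvd_torsionOrder)
    (hGrK : imKummer_ge_strictCondition_goodOrdinary)
    (hT40 : Silverman1994_thmV53_tateUniformisation.{0})
    (hT41 : Silverman1994_thmV53_corV54_tateUniformisation.{0}) (hp2 : p ≠ 2)
    (hG₁ : TypeGOrd W₁ p) (hadd₁ : Addv W₁ p) (he₁ : semistabilityIndex W₁ p = 2)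
    (hpm₂ : PotMult W₂ p) (htors₁ : ¬ p ∣ W₁.torsionOrder) (htors₂ : ¬ p ∣ W₂.torsionOrder)
    (hT : TorsionIso W₁ W₂ p)
    (S₀ : Finset (HeightOneSpectrum (𝓞 ℚ))) (hS₀ : ∀ w ∈ S₀, ((p : ℕ) : 𝓞 ℚ) ∉ w.asIdeal)
    (hS₁ : ∀ w : HeightOneSpectrum (𝓞 ℚ), w ∉ S₀ → ((p : ℕ) : 𝓞 ℚ) ∉ w.asIdeal →
      W₁.HasGoodReductionAt w)
    (hS₂ : ∀ w : HeightOneSpectrum (𝓞 ℚ), w ∉ S₀ → ((p : ℕ) : 𝓞 ℚ) ∉ w.asIdeal →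
      W₂.HasGoodReductionAt w)
    {κ : ZpExtension ℚ p} {γ : absoluteGaloisGroup ℚ} (hκ : κ.IsCyclotomic)
    (hγ : κ.IsTopGenerator γ) (hγ' : IsCyclotomicVariable p γ)
    (D₁ : W₁.SelmerDualData κ γ) (D₂ : W₂.SelmerDualData κ γ)
    [Module.Finite (IwasawaAlgebra p) D₁.X] [Module.Finite (IwasawaAlgebra p) D₂.X]
    (hX₁ : D₁.IsTorsion) (hX₂ : D₂.IsTorsion) (hμ₁ : D₁.mu = 0) : D₂.mu = 0 := by
  obtain ⟨v, hv⟩ := exists_natCast_mem_asIdeal' (p := p)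
  obtain ⟨L₁, L₂, hL₁, hL₂, hmatch⟩ :=
    exists_lines_matching_of_typeGOrd_potMult hT40 hT41 hp2 hG₁ hadd₁ he₁ hpm₂ hv
  obtain ⟨e, he⟩ := hT
  exact mu_eq_zero_of_gv W₁ W₂ p S₀ hGV hp2 hv hL₁ hL₂ htors₁ htors₂
    (ramifiedLineKummerEqAt_of_typeGOrd hGrK hp2 hG₁ hadd₁ he₁)
    (hpm₂.ramifiedLineKummerEqAt hT40 hT41 hp2) ⟨e, he, hmatch e he⟩ hS₀ hS₁ hS₂ hκ hγ hγ' D₁ D₂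
    hX₁ hX₂ hμ₁

/-- **(M)–(G-ord, `e = 2`) congruent pairs (flipped), every odd `p`: `CongruentLambdaShift W₁ W₂ p e`**
from the GV record + `TorsionIso` + `p ∤ #Eᵢ(ℚ)_tors` + `Σ₀`, mod A40/A41 | `hGrK`. Nothing booked.
[cite: GreenbergVatsal2000, §2 Prop. (2.8) with Remark (2.9), Cor. (2.3), Prop. (2.4), pp. 26–27 (arXiv:math/9906215)] -/
theorem congruentLambdaShift_of_gv_of_potMult_typeGOrd
    (hGV : muLambdaAlg_transfer_of_torsionIso_potOrd_of_not_dvd_torsionOrder)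
    (hGrK : imKummer_ge_strictCondition_goodOrdinary)
    (hT40 : Silverman1994_thmV53_tateUniformisation.{0})
    (hT41 : Silverman1994_thmV53_corV54_tateUniformisation.{0}) (hp2 : p ≠ 2)
    (hpm₁ : PotMult W₁ p) (hG₂ : TypeGOrd W₂ p) (hadd₂ : Addv W₂ p)
    (he₂ : semistabilityIndex W₂ p = 2) (htors₁ : ¬ p ∣ W₁.torsionOrder)
    (htors₂ : ¬ p ∣ W₂.torsionOrder) (hT : TorsionIso W₁ W₂ p)
    (S₀ : Finset (HeightOneSpectrum (𝓞 ℚ))) (hS₀ : ∀ w ∈ S₀, ((p : ℕ) : 𝓞 ℚ) ∉ w.asIdeal)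
    (hS₁ : ∀ w : HeightOneSpectrum (𝓞 ℚ), w ∉ S₀ → ((p : ℕ) : 𝓞 ℚ) ∉ w.asIdeal →
      W₁.HasGoodReductionAt w)
    (hS₂ : ∀ w : HeightOneSpectrum (𝓞 ℚ), w ∉ S₀ → ((p : ℕ) : 𝓞 ℚ) ∉ w.asIdeal →
      W₂.HasGoodReductionAt w) :
    CongruentLambdaShift W₁ W₂ p (∑ w ∈ S₀, ((delta W₂ p w : ℤ) - (delta W₁ p w : ℤ))) := by
  obtain ⟨v, hv⟩ := exists_natCast_mem_asIdeal' (p := p)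
  obtain ⟨L₁, L₂, hL₁, hL₂, hmatch⟩ :=
    exists_lines_matching_of_potMult_typeGOrd hT40 hT41 hp2 hpm₁ hG₂ hadd₂ he₂ hv
  obtain ⟨e, he⟩ := hT
  exact congruentLambdaShift_of_gv W₁ W₂ p S₀ hGV hp2 hv hL₁ hL₂ htors₁ htors₂
    (hpm₁.ramifiedLineKummerEqAt hT40 hT41 hp2)
    (ramifiedLineKummerEqAt_of_typeGOrd hGrK hp2 hG₂ hadd₂ he₂) ⟨e, he, hmatch e he⟩ hS₀ hS₁ hS₂

/-- **(M)–(G-ord, `e = 2`) congruent pairs (flipped): `μ(X(E₁)) = 0 ⟹ μ(X(E₂)) = 0`**, mod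
A40/A41 | `hGrK`. Nothing booked.
[cite: GreenbergVatsal2000, §2 Prop. (2.8) with Remark (2.9), Cor. (2.3), pp. 26–27 (arXiv:math/9906215)] -/
theorem mu_eq_zero_of_gv_of_potMult_typeGOrd
    (hGV : muLambdaAlg_transfer_of_torsionIso_potOrd_of_not_dvd_torsionOrder)
    (hGrK : imKummer_ge_strictCondition_goodOrdinary)
    (hT40 : Silverman1994_thmV53_tateUniformisation.{0})
    (hT41 : Silverman1994_thmV53_corV54_tateUniformisation.{0}) (hp2 : p ≠ 2)
    (hpm₁ : PotMult W₁ p) (hG₂ : TypeGOrd W₂ p) (hadd₂ : Addv W₂ p)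
    (he₂ : semistabilityIndex W₂ p = 2) (htors₁ : ¬ p ∣ W₁.torsionOrder)
    (htors₂ : ¬ p ∣ W₂.torsionOrder) (hT : TorsionIso W₁ W₂ p)
    (S₀ : Finset (HeightOneSpectrum (𝓞 ℚ))) (hS₀ : ∀ w ∈ S₀, ((p : ℕ) : 𝓞 ℚ) ∉ w.asIdeal)
    (hS₁ : ∀ w : HeightOneSpectrum (𝓞 ℚ), w ∉ S₀ → ((p : ℕ) : 𝓞 ℚ) ∉ w.asIdeal →
      W₁.HasGoodReductionAt w)
    (hS₂ : ∀ w : HeightOneSpectrum (𝓞 ℚ), w ∉ S₀ → ((p : ℕ) : 𝓞 ℚ) ∉ w.asIdeal →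
      W₂.HasGoodReductionAt w)
    {κ : ZpExtension ℚ p} {γ : absoluteGaloisGroup ℚ} (hκ : κ.IsCyclotomic)
    (hγ : κ.IsTopGenerator γ) (hγ' : IsCyclotomicVariable p γ)
    (D₁ : W₁.SelmerDualData κ γ) (D₂ : W₂.SelmerDualData κ γ)
    [Module.Finite (IwasawaAlgebra p) D₁.X] [Module.Finite (IwasawaAlgebra p) D₂.X]
    (hX₁ : D₁.IsTorsion) (hX₂ : D₂.IsTorsion) (hμ₁ : D₁.mu = 0) : D₂.mu = 0 := by
  obtain ⟨v, hv⟩ := exists_natCast_mem_asIdeal' (p := p)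
  obtain ⟨L₁, L₂, hL₁, hL₂, hmatch⟩ :=
    exists_lines_matching_of_potMult_typeGOrd hT40 hT41 hp2 hpm₁ hG₂ hadd₂ he₂ hv
  obtain ⟨e, he⟩ := hT
  exact mu_eq_zero_of_gv W₁ W₂ p S₀ hGV hp2 hv hL₁ hL₂ htors₁ htors₂
    (hpm₁.ramifiedLineKummerEqAt hT40 hT41 hp2)
    (ramifiedLineKummerEqAt_of_typeGOrd hGrK hp2 hG₂ hadd₂ he₂) ⟨e, he, hmatch e he⟩ hS₀ hS₁ hS₂
    hκ hγ hγ' D₁ D₂ hX₁ hX₂ hμ₁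

/-! ### §2 Class forms -/

/-- **X4♯(G-ord) ∩ `I₀*` row `E₁ = W₁` with an X4(M) partner `E₂ = W₂`: `CongruentLambdaShift W₁ W₂ p e`,
i.e. `λ(X(E₁)) = λ(X(E₂)) + e`** from the GV record + `TorsionIso` + `Σ₀`; torsion conditions by
irreducibility; mod `hGrK` | A40/A41 (receiver class = class of `W₁`, as in `MixedCongruentPartnerEPW`). Nothing booked.
[cite: GreenbergVatsal2000, §2 Prop. (2.8) with Remark (2.9), Cor. (2.3), Prop. (2.4), pp. 26–27 (arXiv:math/9906215)]
[cite: Mazur1977, Ch. III §5, p. 157] -/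
theorem ClassX4Gord.congruentLambdaShift_of_gv_of_multPartner
    (hGV : muLambdaAlg_transfer_of_torsionIso_potOrd_of_not_dvd_torsionOrder)
    (hGrK : imKummer_ge_strictCondition_goodOrdinary)
    (hT40 : Silverman1994_thmV53_tateUniformisation.{0})
    (hT41 : Silverman1994_thmV53_corV54_tateUniformisation.{0})
    (hX₁ : ClassX4Gord W₁ p) (he₁ : semistabilityIndex W₁ p = 2) (hX₂ : ClassX4M W₂ p)
    (hT : TorsionIso W₁ W₂ p)
    (S₀ : Finset (HeightOneSpectrum (𝓞 ℚ))) (hS₀ : ∀ w ∈ S₀, ((p : ℕ) : 𝓞 ℚ) ∉ w.asIdeal)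
    (hS₁ : ∀ w : HeightOneSpectrum (𝓞 ℚ), w ∉ S₀ → ((p : ℕ) : 𝓞 ℚ) ∉ w.asIdeal →
      W₁.HasGoodReductionAt w)
    (hS₂ : ∀ w : HeightOneSpectrum (𝓞 ℚ), w ∉ S₀ → ((p : ℕ) : 𝓞 ℚ) ∉ w.asIdeal →
      W₂.HasGoodReductionAt w) :
    CongruentLambdaShift W₁ W₂ p (∑ w ∈ S₀, ((delta W₂ p w : ℤ) - (delta W₁ p w : ℤ))) :=
  congruentLambdaShift_of_gv_of_typeGOrd_potMult hGV hGrK hT40 hT41 hX₁.addv.1 hX₁.typeGOrd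
    hX₁.addv.2 he₁ (ClassX4M.potMult W₂ p hX₂) hX₁.not_dvd_torsionOrder
    (fun h ↦ not_hasIrreducibleModPGaloisRep_of_dvd_torsionOrder W₂ p h hX₂.irr) hT S₀ hS₀ hS₁ hS₂

/-- **X4♯(G-ord) ∩ `I₀*` row `E₁` with an X4(M) partner `E₂`: `μ(X(E₁)) = 0 ⟹ μ(X(E₂)) = 0`**, mod
`hGrK` | A40/A41. Nothing booked. [cite: GreenbergVatsal2000, §2 Prop. (2.8) with Remark (2.9), Cor. (2.3), pp. 26–27 (arXiv:math/9906215)]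
[cite: Mazur1977, Ch. III §5, p. 157] -/
theorem ClassX4Gord.mu_eq_zero_of_gv_of_multPartner
    (hGV : muLambdaAlg_transfer_of_torsionIso_potOrd_of_not_dvd_torsionOrder)
    (hGrK : imKummer_ge_strictCondition_goodOrdinary)
    (hT40 : Silverman1994_thmV53_tateUniformisation.{0})
    (hT41 : Silverman1994_thmV53_corV54_tateUniformisation.{0})
    (hX₁ : ClassX4Gord W₁ p) (he₁ : semistabilityIndex W₁ p = 2) (hX₂ : ClassX4M W₂ p)
    (hT : TorsionIso W₁ W₂ p)
    (S₀ : Finset (HeightOneSpectrum (𝓞 ℚ))) (hS₀ : ∀ w ∈ S₀, ((p : ℕ) : 𝓞 ℚ) ∉ w.asIdeal)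
    (hS₁ : ∀ w : HeightOneSpectrum (𝓞 ℚ), w ∉ S₀ → ((p : ℕ) : 𝓞 ℚ) ∉ w.asIdeal →
      W₁.HasGoodReductionAt w)
    (hS₂ : ∀ w : HeightOneSpectrum (𝓞 ℚ), w ∉ S₀ → ((p : ℕ) : 𝓞 ℚ) ∉ w.asIdeal →
      W₂.HasGoodReductionAt w)
    {κ : ZpExtension ℚ p} {γ : absoluteGaloisGroup ℚ} (hκ : κ.IsCyclotomic)
    (hγ : κ.IsTopGenerator γ) (hγ' : IsCyclotomicVariable p γ)
    (D₁ : W₁.SelmerDualData κ γ) (D₂ : W₂.SelmerDualData κ γ)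
    [Module.Finite (IwasawaAlgebra p) D₁.X] [Module.Finite (IwasawaAlgebra p) D₂.X]
    (hX₁t : D₁.IsTorsion) (hX₂t : D₂.IsTorsion) (hμ₁ : D₁.mu = 0) : D₂.mu = 0 :=
  mu_eq_zero_of_gv_of_typeGOrd_potMult hGV hGrK hT40 hT41 hX₁.addv.1 hX₁.typeGOrd hX₁.addv.2 he₁
    (ClassX4M.potMult W₂ p hX₂) hX₁.not_dvd_torsionOrder
    (fun h ↦ not_hasIrreducibleModPGaloisRep_of_dvd_torsionOrder W₂ p h hX₂.irr) hT S₀ hS₀ hS₁ hS₂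
    hκ hγ hγ' D₁ D₂ hX₁t hX₂t hμ₁

/-- **X4(M) row `E₁ = W₁` with an X4♯(G-ord) ∩ `I₀*` partner `E₂ = W₂`: `CongruentLambdaShift W₁ W₂ p e`,
i.e. `λ(X(E₁)) = λ(X(E₂)) + e`** — the Route-G budget input of the (M) row from a (G-ord) partner —
torsion conditions by irreducibility; mod A40/A41 | `hGrK`. Nothing booked. [cite: GreenbergVatsal2000, §2 Prop. (2.8) with Remark (2.9), Cor. (2.3), Prop. (2.4), pp. 26–27 (arXiv:math/9906215)]
[cite: Mazur1977, Ch. III §5, p. 157] -/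
theorem ClassX4M.congruentLambdaShift_of_gv_of_gordPartner
    (hGV : muLambdaAlg_transfer_of_torsionIso_potOrd_of_not_dvd_torsionOrder)
    (hGrK : imKummer_ge_strictCondition_goodOrdinary)
    (hT40 : Silverman1994_thmV53_tateUniformisation.{0})
    (hT41 : Silverman1994_thmV53_corV54_tateUniformisation.{0})
    (hX₁ : ClassX4M W₁ p) (hX₂ : ClassX4Gord W₂ p) (he₂ : semistabilityIndex W₂ p = 2)
    (hT : TorsionIso W₁ W₂ p)
    (S₀ : Finset (HeightOneSpectrum (𝓞 ℚ))) (hS₀ : ∀ w ∈ S₀, ((p : ℕ) : 𝓞 ℚ) ∉ w.asIdeal)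
    (hS₁ : ∀ w : HeightOneSpectrum (𝓞 ℚ), w ∉ S₀ → ((p : ℕ) : 𝓞 ℚ) ∉ w.asIdeal →
      W₁.HasGoodReductionAt w)
    (hS₂ : ∀ w : HeightOneSpectrum (𝓞 ℚ), w ∉ S₀ → ((p : ℕ) : 𝓞 ℚ) ∉ w.asIdeal →
      W₂.HasGoodReductionAt w) :
    CongruentLambdaShift W₁ W₂ p (∑ w ∈ S₀, ((delta W₂ p w : ℤ) - (delta W₁ p w : ℤ))) :=
  congruentLambdaShift_of_gv_of_potMult_typeGOrd hGV hGrK hT40 hT41 hX₁.p_ne_two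
    (ClassX4M.potMult W₁ p hX₁) hX₂.typeGOrd hX₂.addv.2 he₂
    (fun h ↦ not_hasIrreducibleModPGaloisRep_of_dvd_torsionOrder W₁ p h hX₁.irr)
    hX₂.not_dvd_torsionOrder hT S₀ hS₀ hS₁ hS₂

/-- **X4(M) row `E₁` with an X4♯(G-ord) ∩ `I₀*` partner `E₂`: `μ(X(E₁)) = 0 ⟹ μ(X(E₂)) = 0`**, mod
A40/A41 | `hGrK`. Nothing booked. [cite: GreenbergVatsal2000, §2 Prop. (2.8) with Remark (2.9), Cor. (2.3), pp. 26–27 (arXiv:math/9906215)]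
[cite: Mazur1977, Ch. III §5, p. 157] -/
theorem ClassX4M.mu_eq_zero_of_gv_of_gordPartner
    (hGV : muLambdaAlg_transfer_of_torsionIso_potOrd_of_not_dvd_torsionOrder)
    (hGrK : imKummer_ge_strictCondition_goodOrdinary)
    (hT40 : Silverman1994_thmV53_tateUniformisation.{0})
    (hT41 : Silverman1994_thmV53_corV54_tateUniformisation.{0})
    (hX₁ : ClassX4M W₁ p) (hX₂ : ClassX4Gord W₂ p) (he₂ : semistabilityIndex W₂ p = 2)
    (hT : TorsionIso W₁ W₂ p)
    (S₀ : Finset (HeightOneSpectrum (𝓞 ℚ))) (hS₀ : ∀ w ∈ S₀, ((p : ℕ) : 𝓞 ℚ) ∉ w.asIdeal)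
    (hS₁ : ∀ w : HeightOneSpectrum (𝓞 ℚ), w ∉ S₀ → ((p : ℕ) : 𝓞 ℚ) ∉ w.asIdeal →
      W₁.HasGoodReductionAt w)
    (hS₂ : ∀ w : HeightOneSpectrum (𝓞 ℚ), w ∉ S₀ → ((p : ℕ) : 𝓞 ℚ) ∉ w.asIdeal →
      W₂.HasGoodReductionAt w)
    {κ : ZpExtension ℚ p} {γ : absoluteGaloisGroup ℚ} (hκ : κ.IsCyclotomic)
    (hγ : κ.IsTopGenerator γ) (hγ' : IsCyclotomicVariable p γ)
    (D₁ : W₁.SelmerDualData κ γ) (D₂ : W₂.SelmerDualData κ γ)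
    [Module.Finite (IwasawaAlgebra p) D₁.X] [Module.Finite (IwasawaAlgebra p) D₂.X]
    (hX₁t : D₁.IsTorsion) (hX₂t : D₂.IsTorsion) (hμ₁ : D₁.mu = 0) : D₂.mu = 0 :=
  mu_eq_zero_of_gv_of_potMult_typeGOrd hGV hGrK hT40 hT41 hX₁.p_ne_two (ClassX4M.potMult W₁ p hX₁)
    hX₂.typeGOrd hX₂.addv.2 he₂
    (fun h ↦ not_hasIrreducibleModPGaloisRep_of_dvd_torsionOrder W₁ p h hX₁.irr)
    hX₂.not_dvd_torsionOrder hT S₀ hS₀ hS₁ hS₂ hκ hγ hγ' D₁ D₂ hX₁t hX₂t hμ₁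

/-- **X3♯(G-ord) ∩ `I₀*` row `E₁ = W₁` with an X3♯(M) partner `E₂ = W₂` (odd `p`):
`CongruentLambdaShift W₁ W₂ p e`, i.e. `λ(X(E₁)) = λ(X(E₂)) + e`** from the GV record + `TorsionIso` +
`p ∤ #Eᵢ(ℚ)_tors` + `Σ₀` — NO image binder (EPW inapplicable on X3); mod `hGrK` | A40/A41. Nothing booked.
[cite: GreenbergVatsal2000, §2 Prop. (2.8) with Remark (2.9), Cor. (2.3), Prop. (2.4), pp. 26–27 (arXiv:math/9906215)] -/
theorem ClassX3Gord.congruentLambdaShift_of_gv_of_multPartner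
    (hGV : muLambdaAlg_transfer_of_torsionIso_potOrd_of_not_dvd_torsionOrder)
    (hGrK : imKummer_ge_strictCondition_goodOrdinary)
    (hT40 : Silverman1994_thmV53_tateUniformisation.{0})
    (hT41 : Silverman1994_thmV53_corV54_tateUniformisation.{0})
    (hX₁ : ClassX3Gord W₁ p) (he₁ : semistabilityIndex W₁ p = 2) (hX₂ : ClassX3M W₂ p)
    (htors₁ : ¬ p ∣ W₁.torsionOrder) (hT : TorsionIso W₁ W₂ p)
    (S₀ : Finset (HeightOneSpectrum (𝓞 ℚ))) (hS₀ : ∀ w ∈ S₀, ((p : ℕ) : 𝓞 ℚ) ∉ w.asIdeal)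
    (hS₁ : ∀ w : HeightOneSpectrum (𝓞 ℚ), w ∉ S₀ → ((p : ℕ) : 𝓞 ℚ) ∉ w.asIdeal →
      W₁.HasGoodReductionAt w)
    (hS₂ : ∀ w : HeightOneSpectrum (𝓞 ℚ), w ∉ S₀ → ((p : ℕ) : 𝓞 ℚ) ∉ w.asIdeal →
      W₂.HasGoodReductionAt w) :
    CongruentLambdaShift W₁ W₂ p (∑ w ∈ S₀, ((delta W₂ p w : ℤ) - (delta W₁ p w : ℤ))) :=
  congruentLambdaShift_of_gv_of_typeGOrd_potMult hGV hGrK hT40 hT41 (ClassX3M.p_ne_two W₂ p hX₂)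
    hX₁.typeGOrd hX₁.addv he₁ (ClassX3M.potMult W₂ p hX₂) htors₁
    (not_dvd_torsionOrder_of_torsionIso hT htors₁) hT S₀ hS₀ hS₁ hS₂

/-- **X3♯(G-ord) ∩ `I₀*` row `E₁` with an X3♯(M) partner `E₂` (odd `p`): `μ(X(E₁)) = 0 ⟹ μ(X(E₂)) = 0`**,
mod `hGrK` | A40/A41. Nothing booked. [cite: GreenbergVatsal2000, §2 Prop. (2.8) with Remark (2.9), Cor. (2.3), pp. 26–27 (arXiv:math/9906215)] -/
theorem ClassX3Gord.mu_eq_zero_of_gv_of_multPartner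
    (hGV : muLambdaAlg_transfer_of_torsionIso_potOrd_of_not_dvd_torsionOrder)
    (hGrK : imKummer_ge_strictCondition_goodOrdinary)
    (hT40 : Silverman1994_thmV53_tateUniformisation.{0})
    (hT41 : Silverman1994_thmV53_corV54_tateUniformisation.{0})
    (hX₁ : ClassX3Gord W₁ p) (he₁ : semistabilityIndex W₁ p = 2) (hX₂ : ClassX3M W₂ p)
    (htors₁ : ¬ p ∣ W₁.torsionOrder) (hT : TorsionIso W₁ W₂ p)
    (S₀ : Finset (HeightOneSpectrum (𝓞 ℚ))) (hS₀ : ∀ w ∈ S₀, ((p : ℕ) : 𝓞 ℚ) ∉ w.asIdeal)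
    (hS₁ : ∀ w : HeightOneSpectrum (𝓞 ℚ), w ∉ S₀ → ((p : ℕ) : 𝓞 ℚ) ∉ w.asIdeal →
      W₁.HasGoodReductionAt w)
    (hS₂ : ∀ w : HeightOneSpectrum (𝓞 ℚ), w ∉ S₀ → ((p : ℕ) : 𝓞 ℚ) ∉ w.asIdeal →
      W₂.HasGoodReductionAt w)
    {κ : ZpExtension ℚ p} {γ : absoluteGaloisGroup ℚ} (hκ : κ.IsCyclotomic)
    (hγ : κ.IsTopGenerator γ) (hγ' : IsCyclotomicVariable p γ)
    (D₁ : W₁.SelmerDualData κ γ) (D₂ : W₂.SelmerDualData κ γ)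
    [Module.Finite (IwasawaAlgebra p) D₁.X] [Module.Finite (IwasawaAlgebra p) D₂.X]
    (hX₁t : D₁.IsTorsion) (hX₂t : D₂.IsTorsion) (hμ₁ : D₁.mu = 0) : D₂.mu = 0 :=
  mu_eq_zero_of_gv_of_typeGOrd_potMult hGV hGrK hT40 hT41 (ClassX3M.p_ne_two W₂ p hX₂) hX₁.typeGOrd
    hX₁.addv he₁ (ClassX3M.potMult W₂ p hX₂) htors₁
    (not_dvd_torsionOrder_of_torsionIso hT htors₁) hT S₀ hS₀ hS₁ hS₂ hκ hγ hγ' D₁ D₂ hX₁t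
    hX₂t hμ₁

/-- **X3♯(M) row `E₁ = W₁` with an X3♯(G-ord) ∩ `I₀*` partner `E₂ = W₂` (odd `p`): `CongruentLambdaShift
W₁ W₂ p e`, i.e. `λ(X(E₁)) = λ(X(E₂)) + e`** — the X3♯(M) node's budget input from a (G-ord) partner, FOR
REAL (no image binder); mod A40/A41 | `hGrK`. Nothing booked.
[cite: GreenbergVatsal2000, §2 Prop. (2.8) with Remark (2.9), Cor. (2.3), Prop. (2.4), pp. 26–27 (arXiv:math/9906215)] -/
theorem ClassX3M.congruentLambdaShift_of_gv_of_gordPartner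
    (hGV : muLambdaAlg_transfer_of_torsionIso_potOrd_of_not_dvd_torsionOrder)
    (hGrK : imKummer_ge_strictCondition_goodOrdinary)
    (hT40 : Silverman1994_thmV53_tateUniformisation.{0})
    (hT41 : Silverman1994_thmV53_corV54_tateUniformisation.{0})
    (hX₁ : ClassX3M W₁ p) (hX₂ : ClassX3Gord W₂ p) (he₂ : semistabilityIndex W₂ p = 2)
    (htors₁ : ¬ p ∣ W₁.torsionOrder) (hT : TorsionIso W₁ W₂ p)
    (S₀ : Finset (HeightOneSpectrum (𝓞 ℚ))) (hS₀ : ∀ w ∈ S₀, ((p : ℕ) : 𝓞 ℚ) ∉ w.asIdeal)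
    (hS₁ : ∀ w : HeightOneSpectrum (𝓞 ℚ), w ∉ S₀ → ((p : ℕ) : 𝓞 ℚ) ∉ w.asIdeal →
      W₁.HasGoodReductionAt w)
    (hS₂ : ∀ w : HeightOneSpectrum (𝓞 ℚ), w ∉ S₀ → ((p : ℕ) : 𝓞 ℚ) ∉ w.asIdeal →
      W₂.HasGoodReductionAt w) :
    CongruentLambdaShift W₁ W₂ p (∑ w ∈ S₀, ((delta W₂ p w : ℤ) - (delta W₁ p w : ℤ))) :=
  congruentLambdaShift_of_gv_of_potMult_typeGOrd hGV hGrK hT40 hT41 (ClassX3M.p_ne_two W₁ p hX₁)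
    (ClassX3M.potMult W₁ p hX₁) hX₂.typeGOrd hX₂.addv he₂ htors₁
    (not_dvd_torsionOrder_of_torsionIso hT htors₁) hT S₀ hS₀ hS₁ hS₂

/-- **X3♯(M) row `E₁` with an X3♯(G-ord) ∩ `I₀*` partner `E₂` (odd `p`): `μ(X(E₁)) = 0 ⟹ μ(X(E₂)) = 0`**,
mod A40/A41 | `hGrK`. Nothing booked. [cite: GreenbergVatsal2000, §2 Prop. (2.8) with Remark (2.9), Cor. (2.3), pp. 26–27 (arXiv:math/9906215)] -/
theorem ClassX3M.mu_eq_zero_of_gv_of_gordPartner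
    (hGV : muLambdaAlg_transfer_of_torsionIso_potOrd_of_not_dvd_torsionOrder)
    (hGrK : imKummer_ge_strictCondition_goodOrdinary)
    (hT40 : Silverman1994_thmV53_tateUniformisation.{0})
    (hT41 : Silverman1994_thmV53_corV54_tateUniformisation.{0})
    (hX₁ : ClassX3M W₁ p) (hX₂ : ClassX3Gord W₂ p) (he₂ : semistabilityIndex W₂ p = 2)
    (htors₁ : ¬ p ∣ W₁.torsionOrder) (hT : TorsionIso W₁ W₂ p)
    (S₀ : Finset (HeightOneSpectrum (𝓞 ℚ))) (hS₀ : ∀ w ∈ S₀, ((p : ℕ) : 𝓞 ℚ) ∉ w.asIdeal)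
    (hS₁ : ∀ w : HeightOneSpectrum (𝓞 ℚ), w ∉ S₀ → ((p : ℕ) : 𝓞 ℚ) ∉ w.asIdeal →
      W₁.HasGoodReductionAt w)
    (hS₂ : ∀ w : HeightOneSpectrum (𝓞 ℚ), w ∉ S₀ → ((p : ℕ) : 𝓞 ℚ) ∉ w.asIdeal →
      W₂.HasGoodReductionAt w)
    {κ : ZpExtension ℚ p} {γ : absoluteGaloisGroup ℚ} (hκ : κ.IsCyclotomic)
    (hγ : κ.IsTopGenerator γ) (hγ' : IsCyclotomicVariable p γ)
    (D₁ : W₁.SelmerDualData κ γ) (D₂ : W₂.SelmerDualData κ γ)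
    [Module.Finite (IwasawaAlgebra p) D₁.X] [Module.Finite (IwasawaAlgebra p) D₂.X]
    (hX₁t : D₁.IsTorsion) (hX₂t : D₂.IsTorsion) (hμ₁ : D₁.mu = 0) : D₂.mu = 0 :=
  mu_eq_zero_of_gv_of_potMult_typeGOrd hGV hGrK hT40 hT41 (ClassX3M.p_ne_two W₁ p hX₁)
    (ClassX3M.potMult W₁ p hX₁) hX₂.typeGOrd hX₂.addv he₂ htors₁
    (not_dvd_torsionOrder_of_torsionIso hT htors₁) hT S₀ hS₀ hS₁ hS₂ hκ hγ hγ'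
    D₁ D₂ hX₁t hX₂t hμ₁

end Summit.BirchSwinnertonDyer.Rank1Residual.AdditivePotMult

end
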